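import Summits.NavierStokesRegularity.NavierStokesRegularity.Theorems.HeredityAtOneT.Negative.AffineEquivarianceTaoClass
import Summits.NavierStokesRegularity.NavierStokesRegularity.Theorems.HeredityAtOneT.Negative.DeadSliceBackwardStage
import HarnessLib

/-!
# Registered stages inherit exactly the rigid symmetries of the design datum (Negative lane, `HeredityAtOneT`)

Stage-level form of `AffineEquivarianceTaoClass` (LADDER-NS N1, items 20304/20305/20303). A
registered stage `s : Stage 1 R S (Margins.routeG R) k` of an UNFORCED design `S` (`S.f = 0`)
carries a finite-energy classical free run `s.u` on `[0, τ_k]` from the rapidly decaying datum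
`S.u₀`; by `DeadSliceBackwardStage.exists_isTaoSolutionOn_of_finiteEnergy_decay` it is Tao-class,
so `AffineEquivarianceTaoClass.conjSlice_eq_iff_datum` applies: for every rigid motion
`x ↦ A x + b` and every `t ∈ [0, τ_k]`,
`conjSlice A b (s.u t) = s.u t ↔ conjSlice A b S.u₀ = S.u₀` (`Stage.conjSlice_eq_iff_datum`),
and the set of symmetry motions of the stage's slices is that of the datum
(`Stage.symmetryMotions_eq_datum`). Consequence for the censuses: a stratum of designs cut out
by a rigid symmetry type (axisymmetric about some axis, helical, plane-symmetric pair, `ℤ/n`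
rotational, centrally symmetric, …) is closed along every registered stage in BOTH time
directions — no live design acquires or loses a rigid symmetry inside a stage; strata are
properties of `Schedule.u₀` alone. Also recorded: the classical `ν = 1` form for any
finite-energy free run with decaying datum (`conjSlice_eq_iff_initial_one`).

WHAT THIS IS NOT: not Navier–Stokes evidence; bookkeeping on landed uniqueness theorems;
sorry-free, std axioms; no item moves.
-/

noncomputable section

open Set
open scoped ENNReal
open Literature.Analysis.FluidPDE
open Summit.NavierStokesRegularity.FluidComputer.PalasekTowerClayBridge
open Summit.NavierStokesRegularity.HeredityAtOneTAffineEquivariance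
open Summit.NavierStokesRegularity.HeredityAtOneTDeadSliceBackwardStage

namespace Summit.NavierStokesRegularity.HeredityAtOneTStageSymmetryMotions

/-- **Classical form, viscosity `1`**: for a finite-energy classical free run on `[0, T] × ℝ³`
with rapidly decaying datum, equivariance under a rigid motion at any `t ∈ [0, T]` is equivalent
to equivariance of the datum. [cite: Temam1997, Ch. III §6.2 Lemma 6.2 (pp. 172-175)] -/
theorem conjSlice_eq_iff_initial_one {T : ℝ} (hT : 0 < T)
    {u : ℝ → EuclideanSpace ℝ (Fin 3) → EuclideanSpace ℝ (Fin 3)}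
    {p : ℝ → EuclideanSpace ℝ (Fin 3) → ℝ}
    (hu : IsClassicalNSSolutionOn (Icc 0 T) 1 0 u p)
    (hE : ∃ C : ℝ≥0∞, C < ⊤ ∧ ∀ t ∈ Icc 0 T, ∫⁻ x, ‖u t x‖ₑ ^ 2 ≤ C)
    (h₀ : HasRapidSpatialDecay (u 0))
    (A : EuclideanSpace ℝ (Fin 3) ≃ₗᵢ[ℝ] EuclideanSpace ℝ (Fin 3)) (b : EuclideanSpace ℝ (Fin 3))
    {t : ℝ} (ht : t ∈ Icc 0 T) : conjSlice A b (u t) = u t ↔ conjSlice A b (u 0) = u 0 := by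
  obtain ⟨q, hq⟩ := exists_isTaoSolutionOn_of_finiteEnergy_decay hT hu hE h₀
  exact conjSlice_eq_iff_datum one_pos hq A b ht

/-- **A registered stage of an unforced design has, at every time of its slab, exactly the rigid
symmetries of the design datum.** [cite: Temam1997, Ch. III §6.2 Lemma 6.2 (pp. 172-175)] -/
theorem Stage.conjSlice_eq_iff_datum {R : TowerRates} (S : Schedule R) (hf : S.f = 0) {k : ℕ}
    (s : Stage 1 R S (Margins.routeG R) k)
    (A : EuclideanSpace ℝ (Fin 3) ≃ₗᵢ[ℝ] EuclideanSpace ℝ (Fin 3)) (b : EuclideanSpace ℝ (Fin 3))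
    {t : ℝ} (ht : t ∈ Icc 0 (S.τ k)) : conjSlice A b (s.u t) = s.u t ↔ conjSlice A b S.u₀ = S.u₀ := by
  have hcl : IsClassicalNSSolutionOn (Icc 0 (S.τ k)) 1 0 s.u s.p := by
    have h := s.classical
    rwa [hf] at h
  have h₀ : HasRapidSpatialDecay (s.u 0) := by
    rw [s.initial]; exact S.datum_decay
  rw [← s.initial]
  exact conjSlice_eq_iff_initial_one (S.τ_pos k) hcl s.energy h₀ A b ht

/-- The readout slice at `τ_k` in particular. [cite: Temam1997, Ch. III §6.2 Lemma 6.2 (pp. 172-175)] -/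
theorem Stage.conjSlice_final_eq_iff_datum {R : TowerRates} (S : Schedule R) (hf : S.f = 0) {k : ℕ}
    (s : Stage 1 R S (Margins.routeG R) k)
    (A : EuclideanSpace ℝ (Fin 3) ≃ₗᵢ[ℝ] EuclideanSpace ℝ (Fin 3)) (b : EuclideanSpace ℝ (Fin 3)) :
    conjSlice A b (s.u (S.τ k)) = s.u (S.τ k) ↔ conjSlice A b S.u₀ = S.u₀ :=
  Stage.conjSlice_eq_iff_datum S hf s A b ⟨(S.τ_pos k).le, le_rfl⟩

/-- **The symmetry motions of a stage's slices are those of the datum** (set form).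
[cite: MajdaBertozziCUP2002, §2.3.3 (2.52)-(2.53)] -/
theorem Stage.symmetryMotions_eq_datum {R : TowerRates} (S : Schedule R) (hf : S.f = 0) {k : ℕ}
    (s : Stage 1 R S (Margins.routeG R) k) {t : ℝ} (ht : t ∈ Icc 0 (S.τ k)) :
    {g : (EuclideanSpace ℝ (Fin 3) ≃ₗᵢ[ℝ] EuclideanSpace ℝ (Fin 3)) × EuclideanSpace ℝ (Fin 3) |
        conjSlice g.1 g.2 (s.u t) = s.u t} =
      {g | conjSlice g.1 g.2 S.u₀ = S.u₀} :=
  Set.ext fun g => Stage.conjSlice_eq_iff_datum S hf s g.1 g.2 ht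

/-- `∀`-form over rate tables, designs, levels and stages (the shape a route file consumes).
[cite: MajdaBertozziCUP2002, §2.3.3 (2.52)-(2.53)] -/
theorem stageSymmetriesAreDatumSymmetries (R : TowerRates) :
    ∀ S : Schedule R, S.f = 0 → ∀ (k : ℕ) (s : Stage 1 R S (Margins.routeG R) k)
      (A : EuclideanSpace ℝ (Fin 3) ≃ₗᵢ[ℝ] EuclideanSpace ℝ (Fin 3)) (b : EuclideanSpace ℝ (Fin 3)),
      ∀ t ∈ Icc 0 (S.τ k), (conjSlice A b (s.u t) = s.u t ↔ conjSlice A b S.u₀ = S.u₀) :=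
  fun S hf _ s A b _ ht => Stage.conjSlice_eq_iff_datum S hf s A b ht

end Summit.NavierStokesRegularity.HeredityAtOneTStageSymmetryMotions

end
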